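import Summits.NavierStokesRegularity.NavierStokesRegularity.Theorems.StrainDoorsMagicCone
import Summits.NavierStokesRegularity.NavierStokesRegularity.Theorems.StrainDoorsSaturationGrowing
import HarnessLib

/-!
# StrainDoorsMagicConeSaturation — ROUND-48 K3: the DYNAMIC (exact-argmax) twin of the blow-up alternative, in 𝒬-form

ROUND-48 (`Theorems/StrainDoorsMagicCone`, nsreg-p1 g34) rewrites the pressure-free local near feed as
`newtonNearFeed = ¼|ω⊥e|² − 𝒬` (`newtonNearFeed_eq_quarter_sub_qExcessMoment`, `𝒬 = qExcessMoment` the quadrupole moment of the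
`q`-excess) and derives the DOOR-form alternative `blowup_alternative` (a blow-up realises F1 `|ω⊥e|² > 4λ²` or F2 `𝒬 < 0` at charged
almost-maximisers). ROUND-47's saturation law (`Theorems/StrainDoorsSaturation{,Growing}`) is the pointwise identity behind it. This file
is the requested K3 (≤ 40 lines): the saturation law in 𝒬-form (`qSaturation_law`), its exact-maximiser cut
(`qSaturation_of_isStrainArgmax`: at an exact strain argmax, `growth + smoothingTerm + ν|strainLap| ≤ ¼|ω⊥e|² − λ² − 𝒬`), and the POINTWISE dynamic twin of the alternative
(`alternative_of_nondecreasing`: if moreover the far field does not out-compress viscosity, `ν·strainLap < smoothingTerm`, then F1 or F2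
holds AT THAT POINT). `--supports stmt-NavierStokesRegularity-0056 --as helper` (ns-s29-p2 g5; ROUND-48.md §(4) K3).

HONEST FRAME: identities/inequalities valid for every classical solution in the S33 frame at exact strain maximisers; items 0056
`NoTypeII`, 10661 and NS regularity are NOT proved; nothing here is a route or a summit statement.
-/

noncomputable section

open MeasureTheory Set Function Filter Metric Real InnerProductSpace
open _root_.Topology
open scoped ENNReal NNReal RealInnerProductSpace ContDiff Laplacian
open Literature.Analysis Literature.Analysis.FluidPDE

set_option linter.dupNamespace false

namespace Summit.NavierStokesRegularity.NavierStokesRegularity.Theorems.StrainDoors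

/-- the SATURATION LAW in 𝒬-form at a critical point of the strain form:
`⟪∂ₜ(∇u e), e⟫ + smoothingTerm − ν·strainLap ≤ ¼(|ω|² − ω_e²) − 𝒬 − λ²`. -/
theorem qSaturation_law {ν T : ℝ} {u : ℝ → (EuclideanSpace ℝ (Fin 3)) → (EuclideanSpace ℝ (Fin 3))}
    {p : ℝ → (EuclideanSpace ℝ (Fin 3)) → ℝ} (hν : 0 < ν) (hT : 0 < T)
    (hsol : IsClassicalNSSolutionOn (Ico 0 T) ν 0 u p) (hreg : ∀ T'' < T, HasBoundedSobolevNormsOn (Icc 0 T'') u)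
    {t : ℝ} (ht : t ∈ Ico 0 T) {r₀ r₁ : ℝ} (hr₀ : 0 < r₀) (hr₁ : r₀ < r₁) {x e : EuclideanSpace ℝ (Fin 3)} (he : ‖e‖ = 1)
    (hcrit : fderiv ℝ (fun y => ⟪fderiv ℝ (u t) y e, e⟫) x = 0) :
    ⟪timeDerivWithin (Ico 0 T) (fun s y => fderiv ℝ (u s) y e) t x, e⟫ + smoothingTerm r₀ r₁ p t x e - ν * strainLap u t x e ≤
      (1 / 4) * (‖curl (u t) x‖ ^ 2 - ⟪curl (u t) x, e⟫ ^ 2) - qExcessMoment r₀ r₁ u t x e - strainQuad u t x e ^ 2 := by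
  rw [← newtonNearFeed_eq_quarter_sub_qExcessMoment hsol ht hr₀ hr₁ x e]
  exact saturation_law hν hT hsol hreg ht hr₀ hr₁ he hcrit

/-- ★ EXACT MAXIMISER, 𝒬-form: at an exact strain argmax (where `strainLap ≤ 0`),
`growth + smoothingTerm + ν·|strainLap| ≤ ¼|ω⊥e|² − λ² − 𝒬` (the F1-defect plus `−𝒬` pays the far field, the viscous loss and the growth;
at a GROWING maximiser all three are being paid). -/
theorem qSaturation_of_isStrainArgmax {ν T : ℝ} {u : ℝ → (EuclideanSpace ℝ (Fin 3)) → (EuclideanSpace ℝ (Fin 3))}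
    {p : ℝ → (EuclideanSpace ℝ (Fin 3)) → ℝ} (hν : 0 < ν) (hT : 0 < T)
    (hsol : IsClassicalNSSolutionOn (Ico 0 T) ν 0 u p) (hreg : ∀ T'' < T, HasBoundedSobolevNormsOn (Icc 0 T'') u)
    {t : ℝ} (ht : t ∈ Ico 0 T) {r₀ r₁ : ℝ} (hr₀ : 0 < r₀) (hr₁ : r₀ < r₁) {x e : EuclideanSpace ℝ (Fin 3)}
    (hax : IsStrainArgmax u t x e) :
    ⟪timeDerivWithin (Ico 0 T) (fun s y => fderiv ℝ (u s) y e) t x, e⟫ + smoothingTerm r₀ r₁ p t x e + ν * |strainLap u t x e| ≤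
      (1 / 4) * (‖curl (u t) x‖ ^ 2 - ⟪curl (u t) x, e⟫ ^ 2) - strainQuad u t x e ^ 2 - qExcessMoment r₀ r₁ u t x e := by
  have hloc : IsLocalMax (fun y => strainQuad u t y e) x := Filter.Eventually.of_forall fun y => hax.2 y e hax.1
  have h := qSaturation_law hν hT hsol hreg ht hr₀ hr₁ hax.1 hloc.fderiv_eq_zero
  have hlap : strainLap u t x e ≤ 0 := strainLap_nonpos_of_isStrainArgmax (hsol.smooth_velocity.contDiff_slice ht) hax
  rw [abs_of_nonpos hlap]
  linarith

/-- ★★ the POINTWISE DYNAMIC TWIN of `blowup_alternative`: at an exact strain argmax where the strain form is non-decreasing and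
the far field does NOT out-compress viscosity (`ν·strainLap < smoothingTerm`), F1 or F2 holds there:
`4λ² < |ω⊥e|²` or `𝒬 < 0`. -/
theorem alternative_of_nondecreasing {ν T : ℝ} {u : ℝ → (EuclideanSpace ℝ (Fin 3)) → (EuclideanSpace ℝ (Fin 3))}
    {p : ℝ → (EuclideanSpace ℝ (Fin 3)) → ℝ} (hν : 0 < ν) (hT : 0 < T)
    (hsol : IsClassicalNSSolutionOn (Ico 0 T) ν 0 u p) (hreg : ∀ T'' < T, HasBoundedSobolevNormsOn (Icc 0 T'') u)
    {t : ℝ} (ht : t ∈ Ico 0 T) {r₀ r₁ : ℝ} (hr₀ : 0 < r₀) (hr₁ : r₀ < r₁) {x e : EuclideanSpace ℝ (Fin 3)}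
    (hax : IsStrainArgmax u t x e) (hgrow : 0 ≤ ⟪timeDerivWithin (Ico 0 T) (fun s y => fderiv ℝ (u s) y e) t x, e⟫)
    (hvisc : ν * strainLap u t x e < smoothingTerm r₀ r₁ p t x e) :
    4 * strainQuad u t x e ^ 2 < ‖curl (u t) x‖ ^ 2 - ⟪curl (u t) x, e⟫ ^ 2 ∨ qExcessMoment r₀ r₁ u t x e < 0 := by
  have hloc : IsLocalMax (fun y => strainQuad u t y e) x := Filter.Eventually.of_forall fun y => hax.2 y e hax.1
  have h := not_parity_of_nondecreasing hν hT hsol hreg ht hr₀ hr₁ hax.1 hloc.fderiv_eq_zero hgrow hvisc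
  rw [newtonNearFeed_eq_quarter_sub_qExcessMoment hsol ht hr₀ hr₁ x e] at h
  by_cases hQ : qExcessMoment r₀ r₁ u t x e < 0
  · exact Or.inr hQ
  · left
    have hQ' : 0 ≤ qExcessMoment r₀ r₁ u t x e := not_lt.1 hQ
    linarith

end Summit.NavierStokesRegularity.NavierStokesRegularity.Theorems.StrainDoors

end
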